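import Literature.AnabelianGeometry.SemiGraphs.TemperedRestrictedUniversalCovering
import Literature.AnabelianGeometry.SemiGraphs.TemperedCoveringsSubgraphBTemp
import Literature.AnabelianGeometry.SemiGraphs.UniversalCoveringOverDevelopProofs
import Literature.AnabelianGeometry.SemiGraphs.UniversalCoveringOverTempered
import HarnessLib

/-!
# Domination of the tempered coverings of `𝒢_ℍ` by restrictions of tempered coverings of `𝒢` (DOM),
# reduced to the FINITE level ([SemiAnbd] §3 p. 38, Def. 3.5 (ii) p. 37; [IUTchI] §2 p. 44)

Mochizuki, *Semi-graphs of anabelioids*, Publ. RIMS **42** (2006), §3: Def. 3.5 (ii) p. 37 (a tempered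
covering is, componentwise, split by a finite étale covering), p. 38 (the coverings `𝒢_{∞,i} → 𝒢`
"determined by the universal graph-covering"; tempered coverings split by `𝒢_i` are dominated by
`𝒢_{∞,i}`) [cite: MochizukiSemiAnbd2006, Prop 3.6 p.38]; Mochizuki, *Inter-universal Teichmüller theory I*,
§2 p. 44 l. 39–44 ("natural … decomposition groups `Π^tp_ℍ ⊆ Π^tp_𝔾`", inclusions of topological groups)
[cite: Mochizuki2012, IUTchI §2 p.44].

PROOF-ONLY file (abc-iut cell, layer L3, row «DECOMP-EMB» part (C2), seat abc-iut-L3-d1 gen 8; no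
definition, no new named fact).  abc-iut-w4-d052's translation (B) shows that the decomposition
homomorphism `φ : π₁^temp(𝒢_ℍ) → π₁^temp(𝒢)` INDUCES THE TOPOLOGY (hence is a closed embedding, which
discharges the displayed hypotheses of the [IUTchI] Prop. 2.2 / Cor. 2.3 (v) closers of abc-iut-w4-d052 /
abc-iut-w5-d240) from the single displayed statement

  (DOM) `∀ (T : B^temp(𝒢_ℍ)) (v ∈ ℍ) (t ∈ T_v), ∃ (S : B^temp(𝒢)) (C : B^temp(𝒢_ℍ)) (ι : C ⟶ S|_ℍ)
        (f : C ⟶ T) (s ∈ C_v), ι injective on the v-fibre ∧ f s = t`.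

This file PROVES (DOM) from its finite shadow

  (FIN) every FINITE covering of `𝒢_ℍ` with nonempty fibres is SPLIT by the restriction to `ℍ` of a
        finite covering of `𝒢` with nonempty fibres

(`dom_of_finiteRestrictSplits`), for `𝒢` countable and Galois-countable ([IUTchI] Rmk. 2.5.3 (i) (T2)).
Construction, for `t ∈ T_v`: a finite `F′` splitting the component of `t` (Def. 3.5 (ii)); by (FIN) a finite
`S` over `𝒢` whose restriction `S|_ℍ` splits `F′`, hence splits `T` along the component of `t`
(`splitsAt_of_splits_of_splitsAt`); `C := 𝒢_ℍ,{∞,S|ℍ}` the universal graph-covering of `𝒢_ℍ` over `S|_ℍ`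
based at `x₀ ∈ S_v` (tempered: split by the restriction of a member of the Galois-countability family
splitting `S`), `f : C ⟶ T` the developing map through `t` (abc-iut-L3-t9's
`exists_hom_univCoverOver_of_splitsAt`), `S^∞ := 𝒢_{∞,S}` (tempered, abc-iut-L3-d5/t9) and
`ι : C ⟶ S^∞|_ℍ` the fibre-injective comparison morphism of `TemperedRestrictedUniversalCovering.lean`
(abc-iut-L3-d1).  So after this file the ONE residual of (DOM) — hence of the closed-embedding property
of `Π^tp_ℍ ⊆ Π^tp_𝔾` — is (FIN), a statement about FINITE étale coverings only ([SemiAnbd] Prop. 2.5 (i)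
territory: injectivity of `Π̂_{𝒢_ℍ} → Π̂_𝒢`, in the tree as `piHToPi_injective` on the `B(𝒢)` side).
Nothing here takes a side on [IUTchIII] Cor. 3.12; typed ≠ proved for (FIN).
-/

namespace Literature.AnabelianGeometry.SemiGraphs

namespace ProfiniteSemiGraph

open CategoryTheory

universe u

variable {𝒢 : ProfiniteSemiGraph.{u}} (H : 𝒢.graph.Subgraph)

/-! ### Splitting bookkeeping -/

/-- Restriction to `ℍ` preserves splitting (same fibres, same stabilisers).
[cite: MochizukiSemiAnbd2006, Def 3.5(ii) p.37] -/
theorem CovObj.Splits.covRestrict {F S : CovObj 𝒢} (h : F.Splits S) :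
    ((𝒢.covRestrict H).obj F).Splits ((𝒢.covRestrict H).obj S) :=
  ⟨fun w x g hgx s => h.1 w.1 x g hgx s, fun e x g hgx s => h.2 e.1 x g hgx s⟩

/-- **Transitivity of splitting at a point**: if `A` splits `F′` (the stabilisers of the points of `A`
act trivially on the fibres of `F′`), `F′` has nonempty fibres and `F′` splits `T` at `q`, then `A` splits
`T` at `q`. [cite: MochizukiSemiAnbd2006, Def 3.5(ii) p.37] -/
theorem CovObj.splitsAt_of_splits_of_splitsAt {𝒦 : ProfiniteSemiGraph.{u}} {A F' T : CovObj 𝒦}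
    (hAF : A.Splits F') (hne : F'.HasNonemptyFibres) (q : T.Point) (hq : F'.SplitsAt T q) :
    A.SplitsAt T q := by
  rcases q with ⟨w, s⟩ | ⟨e, s⟩
  · intro x g hgx
    obtain ⟨x'⟩ := hne.nonempty_V w
    exact hq x' g (hAF.1 w x g hgx x')
  · intro x g hgx
    obtain ⟨x'⟩ := hne.nonempty_E e
    exact hq x' g (hAF.2 e x g hgx x')

/-! ### (DOM) from (FIN) -/

/-- **(DOM) ⟸ (FIN).**  If every finite covering of `𝒢_ℍ` with nonempty fibres is split by the
restriction of a finite covering of `𝒢` with nonempty fibres, then every tempered covering `T` of `𝒢_ℍ`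
is pointedly dominated by a fibre-injective sub-covering of the restriction of a tempered covering of
`𝒢`: for `t ∈ T_v` take `S^∞ := 𝒢_{∞,S}` for a finite `S` whose restriction splits the component of
`t`, `C := 𝒢_ℍ,{∞,S|ℍ}`, `ι` the comparison morphism and `f` the developing map through `t` — the
displayed hypothesis `hdom` of abc-iut-w4-d052's "the decomposition homomorphism induces the topology"
([IUTchI] §2 p. 44, inclusions `Π^tp_ℍ ⊆ Π^tp_𝔾`). [cite: Mochizuki2012, IUTchI §2 p.44] -/
theorem dom_of_finiteRestrictSplits (h𝒢 : 𝒢.IsCountable) (hGC : 𝒢.IsGaloisCountable)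
    (hfin : ∀ F' : CovObj (𝒢.restrict H), F'.IsFinite → F'.HasNonemptyFibres →
      ∃ S : CovObj 𝒢, S.IsFinite ∧ S.HasNonemptyFibres ∧ ((𝒢.covRestrict H).obj S).Splits F')
    (T : BTempCat (𝒢.restrict H)) (v : H.toSemiGraph.Vertex) (t : (T.obj.SV v).obj.V) :
    ∃ (S : BTempCat 𝒢) (C : BTempCat (𝒢.restrict H)) (ι : C ⟶ (𝒢.btempRestrict H).obj S)
      (f : C ⟶ T) (s : (C.obj.SV v).obj.V),
      Function.Injective (ι.hom.fV v).hom.hom ∧ (f.hom.fV v).hom.hom s = t := by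
  have hH : (𝒢.restrict H).IsCountable := ⟨by haveI := h𝒢.countable_vertex; exact Subtype.countable,
    by haveI := h𝒢.countable_edge; exact Subtype.countable⟩
  -- a finite covering of `𝒢_ℍ` splitting the component of `t`
  obtain ⟨F', hF'fin, hF'ne, hF'split⟩ := T.property (Sum.inl ⟨v, t⟩)
  -- (FIN): a finite covering of `𝒢` whose restriction splits `F'`
  obtain ⟨S, hSfin, hSne, hSsplit⟩ := hfin F' hF'fin hF'ne
  have hsplitT : ∀ q, T.obj.SameComponent (Sum.inl ⟨v, t⟩) q →
      ((𝒢.covRestrict H).obj S).SplitsAt T.obj q := fun q hq =>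
    CovObj.splitsAt_of_splits_of_splitsAt hSsplit hF'ne q (hF'split q hq)
  obtain ⟨x₀⟩ := hSne.nonempty_V v.1
  -- the developing map `𝒢_ℍ,{∞,S|ℍ} ⟶ T` through `t`
  obtain ⟨φ, hφ⟩ := CovObj.exists_hom_univCoverOver_of_splitsAt hH ((𝒢.covRestrict H).obj S) T.obj v
    x₀ t hsplitT
  -- temperedness of `𝒢_{∞,S}` (over `𝒢`) and of `𝒢_ℍ,{∞,S|ℍ}` (over `𝒢_ℍ`)
  have hStemp : (S.univCoverOver (Sum.inl (Quot.mk S.VRel ⟨v.1, x₀⟩)) h𝒢).IsTempered :=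
    CovObj.univCoverOver_isTempered_of_isGaloisCountable S _ h𝒢 hGC hSfin
  obtain ⟨Fam, hFam, hcof⟩ := hGC.2
  obtain ⟨i, hi⟩ := hcof S hSfin
  have hCtemp : (((𝒢.covRestrict H).obj S).univCoverOver
      (Sum.inl (Quot.mk ((𝒢.covRestrict H).obj S).VRel ⟨v, x₀⟩)) hH).IsTempered :=
    CovObj.univCoverOver_isTempered_of_splits ((𝒢.covRestrict H).obj (Fam i)) ((𝒢.covRestrict H).obj S)
      _ hH ((hFam i).1.covRestrict H) ((hFam i).2.covRestrict H)
      (CovObj.Splits.covRestrict H hi)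
  refine ⟨⟨S.univCoverOver (Sum.inl (Quot.mk S.VRel ⟨v.1, x₀⟩)) h𝒢, hStemp⟩,
    ⟨((𝒢.covRestrict H).obj S).univCoverOver (Sum.inl (Quot.mk _ ⟨v, x₀⟩)) hH, hCtemp⟩,
    ObjectProperty.homMk (CovObj.restrictUnivCoverHom H S h𝒢 hH x₀), ObjectProperty.homMk φ,
    ⟨⟨Quot.mk _ ⟨v, x₀⟩, rfl⟩, ⟨⟨x₀, rfl⟩, 𝟙 _⟩⟩, ?_, ?_⟩
  · exact CovObj.restrictUnivCoverHom_fV_injective H S h𝒢 hH x₀ v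
  · exact hφ

/-- **(DOM) ⟸ (FIN), packaged form**: the displayed hypothesis `hdom` of the (B) translation as a single
implication, `𝒢` countable and Galois-countable. [cite: Mochizuki2012, IUTchI §2 p.44] -/
theorem dom_of_finiteRestrictSplits' (h𝒢 : 𝒢.IsCountable) (hGC : 𝒢.IsGaloisCountable)
    (hfin : ∀ F' : CovObj (𝒢.restrict H), F'.IsFinite → F'.HasNonemptyFibres →
      ∃ S : CovObj 𝒢, S.IsFinite ∧ S.HasNonemptyFibres ∧ ((𝒢.covRestrict H).obj S).Splits F') :
    ∀ (T : BTempCat (𝒢.restrict H)) (v : H.toSemiGraph.Vertex) (t : (T.obj.SV v).obj.V),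
      ∃ (S : BTempCat 𝒢) (C : BTempCat (𝒢.restrict H)) (ι : C ⟶ (𝒢.btempRestrict H).obj S)
        (f : C ⟶ T) (s : (C.obj.SV v).obj.V),
        Function.Injective (ι.hom.fV v).hom.hom ∧ (f.hom.fV v).hom.hom s = t :=
  fun T v t => dom_of_finiteRestrictSplits H h𝒢 hGC hfin T v t

end ProfiniteSemiGraph

end Literature.AnabelianGeometry.SemiGraphs
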